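/-
Copyright (c) 2026 the pub-hodgecm-mathlib formalisation cell (harness21).  Prover seat hodgecm-mathlib-LH5-p05 (g6); dealer LH4-plan (g7) WORD 16:40Z (the `…Closed`
junction of (C5)′ LARGE, LH4-p01 (g6)), 2026-09-02.  Body = ★ `UnitOrbitalIntegralInertCountJPosClosed`'s pattern over the 2-free (C2)′ package.
-/
import Literature.NumberTheory.Rogawski1990.UnitOrbitalIntegralInertCountJZeroLargeDispatchGuardedTrace   -- GUARDED sibling of ★ p852151 L2 (LH5-p05 over LH4-p01 (g6)'s text): `natCard_cosets_jzero_eq_iThirteen_of_lt_of_rel_guarded{,'}` (`hSN`, `[Finite]`, `hfib` as hypotheses)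
import Literature.NumberTheory.Automorphic.UnitaryThreePHTowerPackageTrace                      -- ★ p852072 C2-C: `finite_quotient_flickerHK_of_rel`, `natCard_fibre_flickerPHRho_eq_of_rel`
import Literature.NumberTheory.Automorphic.UnitaryThreePHTowerIndexTrace                        -- ★ p852004 C2-B: `inf_flickerHK_le_flickerPH0_of_rel`
import HarnessLib

/-!
# Flicker's PROPOSITION 13 for `m > N`, closed form, WITHOUT `|2| = 1`: the trace-frame dispatch `(#cosets : ℚ) = iThirteen q N N₊ M m` with Prop. 8's numbers
# discharged by the 2-free package (C2)′ (Flicker 1998, Prop. 13 (d)(e) pp. 91–92, Prop. 8 p. 84 — every residue characteristic)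

Topic `NumberTheory/Rogawski1990` (half A line LH4, LAYER C of the (D-UNR) type-(1) column, (C5)′ row «CountJZeroLarge» of CENSUS-C5 bd72510a (LH3-p02 (g6)) — its
`…Closed` junction; dealer LH4-plan (g7) WORD 16:40Z); namespace `Literature.NumberTheory.Automorphic.UnitaryGroup` (= ★'s).  THEOREMS ONLY: no definition, no named fact,
no instance, no notation, no `sorry`; kernel lane `--supports stmt-HodgeConjecture-24833`.

The GUARDED sibling `UnitOrbitalIntegralInertCountJZeroLargeDispatchGuardedTrace` of (C5)′ L2 ★ p852151 (LH4-p01 (g6); guard tokens `|κ| = 1`, `N ≤ N₊ → |r| ≤ 1` of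
LH4-plan (g7) WORD #57) proves the `m > N` half of Prop. 13 in the trace frame — `(Nat.card {…} : ℚ) = iThirteen q N N₊ M m`
for the torus corner `τ = !![A,0,B₁; 0,b,0; B₂,0,D]` under the `j = 0` letters of ★ FILE 1 — modulo the three Prop-8 inputs `hSN` (`P_H ∩ H^K_m ≤ N₀`), `[Finite (P_H ⧸ S)]` and
`hfib` (fibres of `ρ_m` have `q^m` elements), exactly as ★ `natCard_cosets_jzero_eq_iThirteen_of_lt{,'}` did in Flicker's frame (heads `natCard_cosets_jzero_eq_iThirteen_of_lt_of_rel_guarded{,'}`).  The 2-free package proves all three in the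
same binder text for the level element `u_m^{(y,z)}`: ★ p852004 C2-B `inf_flickerHK_le_flickerPH0_of_rel`, ★ p852072 C2-C `finite_quotient_flickerHK_of_rel` and
`natCard_fibre_flickerPHRho_eq_of_rel`.  This file plugs them in — **`natCard_cosets_jzero_eq_iThirteen_of_lt_of_rel_of_package`** and the `N = 0`-admitting ED. 2
**`natCard_cosets_jzero_eq_iThirteen_of_lt_of_rel_of_package'`**: every binder of the guarded L2 heads VERBATIM except that `hSN ∕ [Finite] ∕ hfib` are DELETED (nothing added);
the case-(e) values-abstract binder `hce` (the norm-residue count `(q+1)²q^{2m+N−2}` under its pointwise `X`-criterion) stays a hypothesis exactly as in L2 and in ★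
(it is not a Prop-8 number).  Pattern = ★ `natCard_cosets_eq_iTen_of_package` ∕ my JPos `…ClosedTrace`.  CONCLUSION `(Nat.card {…} : ℚ) = iThirteen q N Np M m` VERBATIM.
FINDING #19 status: the half `m > N` carries no residue-characteristic correction in any cell (LARGE census (6), dealer WORD #44 (c1) ledger «LARGE ∕ BOX: none»).
HONEST LABEL: HC_CM is proved only modulo the 7 printed citations (2 remaining: hLiu418 = stmt-HodgeConjecture-24832, h413 = stmt-HodgeConjecture-24833) until rung 0
closes; this file is a 20-line junction, count-neutral ((D-UNR) PRINT by D74′).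

## References
* [Flicker1998UnitaryFL] Y. Z. Flicker, *Elementary proof of the fundamental lemma for a unitary group*, Canad. J. Math. 50 (1998), 74–98: Prop. 13 (d)(e) pp. 91–92, Prop. 8 p. 84.
* [Rogawski1990] J. D. Rogawski, *Automorphic Representations of Unitary Groups in Three Variables* (1990), §4.9 p. 55.
-/

set_option autoImplicit false

open scoped MatrixGroups WithZero Valued
open Matrix

namespace Literature.NumberTheory.Automorphic

namespace UnitaryGroup

open Literature.NumberTheory.Automorphic.HermitianLattice (unitaryInt mem_unitaryInt_iff UnramifiedLocalConjDatum)
open Literature.NumberTheory.Rogawski1990.Flicker1998 (iThirteen)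
open IsLocalRing

variable {K : Type*} [Field K] [Valued K ℤᵐ⁰] {ϖ : K} (σ : K →+* K) {J : Matrix (Fin 3) (Fin 3) K}
variable [IsDiscreteValuationRing 𝒪[K]] [Finite (ResidueField 𝒪[K])] [IsAdicComplete (maximalIdeal 𝒪[K]) 𝒪[K]]

/-- **FLICKER'S PROPOSITION 13, the half `N < m`, TRACE FRAME, Prop. 8's numbers discharged** (2-free; twin of ★ `natCard_cosets_jzero_eq_iThirteen_of_lt` with B-p04's
package plugged in): for the torus corner `τ = !![A,0,B₁; 0,b,0; B₂,0,D] ∈ H` with the `j = 0` letters of ★ FILE 1 (`B₁ = κσκB₂`, `A − D = (σκ − κ)B₂`, `B₂G = (D − b − κB₂)s`,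
`r(κ + σκ) = b₀G + σb₀σG`, `z + r = κw₀ + y₀`), `|B₂| = |ϖ^N|`, the exponent data `hreg` and the case-(e) values-abstract count `hce`, and the 2-free level element `u_m^{(y,z)}`:
`(#{w ∈ P_H ⧸ (P_H ∩ H^K_m) : w̃⁻¹ τ w̃ ∈ H^K_m} : ℚ) = iThirteen q N N₊ M m` — `natCard_cosets_jzero_eq_iThirteen_of_lt_of_rel_guarded` with `hSN ∕ [Finite] ∕ hfib` supplied by
★ C2-B p852004 and ★ C2-C p852072. [cite: Flicker1998UnitaryFL, Prop. 13 (d)(e) pp. 91–92; Prop. 8 p. 84] -/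
theorem natCard_cosets_jzero_eq_iThirteen_of_lt_of_rel_of_package (hJ : J = (StdForm.antidiagonal 3).over K) (hd : UnramifiedLocalConjDatum σ ϖ) (h2 : (2 : K) ≠ 0)
    (hσO : ∀ y : 𝒪[K], (σ.comp 𝒪[K].subtype) y ∈ 𝒪[K]) {y z : K} (hy : Valued.v y = 1) (hzv : Valued.v z ≤ 1) (hz : z + σ z + y * σ y = 0)
    {m N Np M : ℕ} (hNm : N < m)
    {c um τ : ↥(unitaryGroupOfForm σ J)} (hc : ((c : GL (Fin 3) K) : Matrix (Fin 3) (Fin 3) K) = !![1, 0, 0; 0, -1, 0; 0, 0, 1])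
    (hum : ((um : GL (Fin 3) K) : Matrix (Fin 3) (Fin 3) K) = !![ϖ ^ m, y, z * (ϖ ^ m)⁻¹; 0, 1, -σ y * (ϖ ^ m)⁻¹; 0, 0, (ϖ ^ m)⁻¹])
    {A B₁ B₂ D b κ b₀ G r s w₀ y₀ : K} (hs : s = -(y * σ y)) (hκ : Valued.v κ = 1) (htr : Valued.v (κ + σ κ) = 1) (hrv : N ≤ Np → Valued.v r ≤ 1)
    (hb₀ : b₀ + σ b₀ = 1) (hb₀v : Valued.v b₀ ≤ 1)
    (hB₁ : B₁ = κ * σ κ * B₂) (hAD : A - D = (σ κ - κ) * B₂) (hG : B₂ * G = (D - b - κ * B₂) * s) (hr : r * (κ + σ κ) = b₀ * G + σ b₀ * σ G)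
    (hc0 : z + r = κ * w₀ + y₀) (hσw₀ : σ w₀ = w₀) (hσy₀ : σ y₀ = -y₀)
    (hτ : ((τ : GL (Fin 3) K) : Matrix (Fin 3) (Fin 3) K) = !![A, 0, B₁; 0, b, 0; B₂, 0, D])
    (hτH : τ ∈ Subgroup.centralizer ({c} : Set ↥(unitaryGroupOfForm σ J)))
    (hB : Valued.v B₂ = Valued.v (ϖ ^ N)) (hsδ : Np < N → Valued.v (D - b) = Valued.v (ϖ ^ Np))
    (hreg : Np < N ∨ (N ≤ Np ∧ N ≤ M ∧ Valued.v (r * (s + r)) = Valued.v (ϖ ^ (M - N)) ∧ Valued.v (G - σ G) = Valued.v (ϖ ^ M)))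
    {q : ℕ} (hq : Nat.card (ResidueField 𝒪[K]) = q ^ 2)
    {a₀ : 𝒪[K]} (ha₀ : IsUnit (((σ.comp 𝒪[K].subtype).codRestrict 𝒪[K] hσO) a₀ - a₀))
    (hce : N ≤ Np → M < 2 * m → 2 * m ≤ M + N → (M - N) % 2 = 0 →
      (∀ p ∈ flickerPH σ J c, ∀ u x w : K,
        ((p : GL (Fin 3) K) : Matrix (Fin 3) (Fin 3) K) = !![u, 0, u * x; 0, w, 0; 0, 0, (σ u)⁻¹] →
          (p⁻¹ * τ * p ∈ flickerHK σ J c um ↔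
            Valued.v ((κ * (u * σ u)⁻¹ + (x + z) + r) * σ (κ * (u * σ u)⁻¹ + (x + z) + r) - r * (s + r)) ≤ Valued.v (ϖ ^ (2 * m - N)))) →
      Nat.card {w : ↥(flickerPH σ J c) ⧸ (flickerHK σ J c um).subgroupOf (flickerPH σ J c) //
        ((Quotient.out w : ↥(flickerPH σ J c)) : ↥(unitaryGroupOfForm σ J))⁻¹ * τ * (Quotient.out w : ↥(flickerPH σ J c)) ∈ flickerHK σ J c um} =
        (q + 1) ^ 2 * q ^ (2 * m + N - 2)) :
    (Nat.card {w : ↥(flickerPH σ J c) ⧸ (flickerHK σ J c um).subgroupOf (flickerPH σ J c) //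
      ((Quotient.out w : ↥(flickerPH σ J c)) : ↥(unitaryGroupOfForm σ J))⁻¹ * τ * (Quotient.out w : ↥(flickerPH σ J c)) ∈ flickerHK σ J c um} : ℚ) =
      iThirteen q N Np M m := by
  haveI := finite_quotient_flickerHK_of_rel σ hJ hd h2 hy hzv hz hσO m hum hc hq ha₀
  exact natCard_cosets_jzero_eq_iThirteen_of_lt_of_rel_guarded σ hJ hd h2 hσO hy hzv hz hNm hc hum hs hκ htr hrv hb₀ hb₀v hB₁ hAD hG hr hc0 hσw₀ hσy₀ hτ hτH hB hsδ hreg hq ha₀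
    (inf_flickerHK_le_flickerPH0_of_rel σ hJ hd h2 hy hzv hz m hum hc)
    (natCard_fibre_flickerPHRho_eq_of_rel σ hJ hd h2 hy hzv hz hσO m hum hc hq ha₀) hce

/-- **PROP. 13, `N < m`, TRACE FRAME, ED. 2 (`N = 0` admitted), Prop. 8's numbers discharged** (2-free; twin of ★ `natCard_cosets_jzero_eq_iThirteen_of_lt'` with B-p04's
package plugged in): as `natCard_cosets_jzero_eq_iThirteen_of_lt_of_rel_of_package`, the type-B datum WEAKENED to `|r(s+r)| ≤ |ϖ^{M−N}|` with `=` only for `1 ≤ N` —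
`natCard_cosets_jzero_eq_iThirteen_of_lt_of_rel_guarded'` with `hSN ∕ [Finite] ∕ hfib` supplied by ★ C2-B p852004 and ★ C2-C p852072. [cite: Flicker1998UnitaryFL, Prop. 13 (d)(e) pp. 91–92; Prop. 8 p. 84] -/
theorem natCard_cosets_jzero_eq_iThirteen_of_lt_of_rel_of_package' (hJ : J = (StdForm.antidiagonal 3).over K) (hd : UnramifiedLocalConjDatum σ ϖ) (h2 : (2 : K) ≠ 0)
    (hσO : ∀ y : 𝒪[K], (σ.comp 𝒪[K].subtype) y ∈ 𝒪[K]) {y z : K} (hy : Valued.v y = 1) (hzv : Valued.v z ≤ 1) (hz : z + σ z + y * σ y = 0)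
    {m N Np M : ℕ} (hNm : N < m)
    {c um τ : ↥(unitaryGroupOfForm σ J)} (hc : ((c : GL (Fin 3) K) : Matrix (Fin 3) (Fin 3) K) = !![1, 0, 0; 0, -1, 0; 0, 0, 1])
    (hum : ((um : GL (Fin 3) K) : Matrix (Fin 3) (Fin 3) K) = !![ϖ ^ m, y, z * (ϖ ^ m)⁻¹; 0, 1, -σ y * (ϖ ^ m)⁻¹; 0, 0, (ϖ ^ m)⁻¹])
    {A B₁ B₂ D b κ b₀ G r s w₀ y₀ : K} (hs : s = -(y * σ y)) (hκ : Valued.v κ = 1) (htr : Valued.v (κ + σ κ) = 1) (hrv : N ≤ Np → Valued.v r ≤ 1)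
    (hb₀ : b₀ + σ b₀ = 1) (hb₀v : Valued.v b₀ ≤ 1)
    (hB₁ : B₁ = κ * σ κ * B₂) (hAD : A - D = (σ κ - κ) * B₂) (hG : B₂ * G = (D - b - κ * B₂) * s) (hr : r * (κ + σ κ) = b₀ * G + σ b₀ * σ G)
    (hc0 : z + r = κ * w₀ + y₀) (hσw₀ : σ w₀ = w₀) (hσy₀ : σ y₀ = -y₀)
    (hτ : ((τ : GL (Fin 3) K) : Matrix (Fin 3) (Fin 3) K) = !![A, 0, B₁; 0, b, 0; B₂, 0, D])
    (hτH : τ ∈ Subgroup.centralizer ({c} : Set ↥(unitaryGroupOfForm σ J)))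
    (hB : Valued.v B₂ = Valued.v (ϖ ^ N)) (hsδ : Np < N → Valued.v (D - b) = Valued.v (ϖ ^ Np))
    (hreg : Np < N ∨ (N ≤ Np ∧ N ≤ M ∧ Valued.v (r * (s + r)) ≤ Valued.v (ϖ ^ (M - N)) ∧
      (1 ≤ N → Valued.v (r * (s + r)) = Valued.v (ϖ ^ (M - N))) ∧ Valued.v (G - σ G) = Valued.v (ϖ ^ M)))
    {q : ℕ} (hq : Nat.card (ResidueField 𝒪[K]) = q ^ 2)
    {a₀ : 𝒪[K]} (ha₀ : IsUnit (((σ.comp 𝒪[K].subtype).codRestrict 𝒪[K] hσO) a₀ - a₀))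
    (hce : N ≤ Np → M < 2 * m → 2 * m ≤ M + N → (M - N) % 2 = 0 →
      (∀ p ∈ flickerPH σ J c, ∀ u x w : K,
        ((p : GL (Fin 3) K) : Matrix (Fin 3) (Fin 3) K) = !![u, 0, u * x; 0, w, 0; 0, 0, (σ u)⁻¹] →
          (p⁻¹ * τ * p ∈ flickerHK σ J c um ↔
            Valued.v ((κ * (u * σ u)⁻¹ + (x + z) + r) * σ (κ * (u * σ u)⁻¹ + (x + z) + r) - r * (s + r)) ≤ Valued.v (ϖ ^ (2 * m - N)))) →
      Nat.card {w : ↥(flickerPH σ J c) ⧸ (flickerHK σ J c um).subgroupOf (flickerPH σ J c) //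
        ((Quotient.out w : ↥(flickerPH σ J c)) : ↥(unitaryGroupOfForm σ J))⁻¹ * τ * (Quotient.out w : ↥(flickerPH σ J c)) ∈ flickerHK σ J c um} =
        (q + 1) ^ 2 * q ^ (2 * m + N - 2)) :
    (Nat.card {w : ↥(flickerPH σ J c) ⧸ (flickerHK σ J c um).subgroupOf (flickerPH σ J c) //
      ((Quotient.out w : ↥(flickerPH σ J c)) : ↥(unitaryGroupOfForm σ J))⁻¹ * τ * (Quotient.out w : ↥(flickerPH σ J c)) ∈ flickerHK σ J c um} : ℚ) =
      iThirteen q N Np M m := by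
  haveI := finite_quotient_flickerHK_of_rel σ hJ hd h2 hy hzv hz hσO m hum hc hq ha₀
  exact natCard_cosets_jzero_eq_iThirteen_of_lt_of_rel_guarded' σ hJ hd h2 hσO hy hzv hz hNm hc hum hs hκ htr hrv hb₀ hb₀v hB₁ hAD hG hr hc0 hσw₀ hσy₀ hτ hτH hB hsδ hreg hq ha₀
    (inf_flickerHK_le_flickerPH0_of_rel σ hJ hd h2 hy hzv hz m hum hc)
    (natCard_fibre_flickerPHRho_eq_of_rel σ hJ hd h2 hy hzv hz hσO m hum hc hq ha₀) hce

end UnitaryGroup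

end Literature.NumberTheory.Automorphic
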